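import Mathlib.Analysis.InnerProductSpace.Projection.Minimal
import Mathlib.RepresentationTheory.Basic
import HarnessLib

/-!
# Fixed vectors of an isometric group action next to an almost-invariant vector (integral-free averaging)

Topic `RepresentationTheory/Unitary`; namespace `Literature.RepresentationTheory.Unitary`.  KERNEL ONLY: theorems; no
definition, no named fact, no record, no `sorry`.

Let a group `G` act on a complex Hilbert space `E` by linear isometries (`π : Representation ℂ G E`,
`‖π g v‖ = ‖v‖`), let `H ≤ G` be a subgroup and `S` a closed subspace stable under `π(H)`.  If `v ∈ S` is ALMOST
`H`-invariant, `‖π h v - v‖ ≤ ε` for all `h ∈ H`, then there is an EXACTLY `H`-invariant `u ∈ S` with `‖u - v‖ ≤ ε`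
(`exists_fixed_near_of_forall_norm_sub_le`); in particular `u ≠ 0` as soon as `ε < ‖v‖`
(`exists_fixed_ne_zero_of_forall_norm_sub_lt`).  Proof: the set `K = {u ∈ S | ∀ h ∈ H, ‖u - π h v‖ ≤ ε}` is non-empty
(it contains `v`), closed, convex and `π(H)`-stable (the `π h` are isometries and `H` is a group); its point of minimal
norm (Hilbert projection theorem, Mathlib `exists_norm_eq_iInf_of_complete_convex`) is unique (parallelogram law,
`eq_of_forall_norm_le_of_midpoint_mem`) hence fixed by every `π h`, `h ∈ H` — the "centre" argument of
[BekkaHarpeValette2008, §2.2 Lemma 2.2.7, Prop. 2.2.9] run on this set instead of the circumscribed ball.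

This is the Hilbert-space substitute for the averaging projection `∫_H π(h) v dh` over a compact (open) subgroup: it
needs neither a Haar measure on `H` nor a Bochner integral, only that the orbit of `v` stays within `ε` of `v` — which for
a strongly continuous representation holds on a small enough open subgroup.  It is the first step of the tree's kernel proof
of the UNIQUENESS half of the Stone–von Neumann theorem over a non-archimedean local field
(`HeisenbergGroup/StoneVonNeumannUniqueness.lean`: lattice-fixed vectors exist in every unitary representation of the
Heisenberg group with central character `ψ`).  The argument is the standard "minimal point of a closed convex invariant
set" proof of the Alaoglu–Birkhoff / mean ergodic fixed-point principle; nothing beyond Mathlib is used.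

## References
* [BekkaHarpeValette2008] B. Bekka, P. de la Harpe, A. Valette, *Kazhdan's Property (T)*, CUP (2008), §2.2: Lemma 2.2.7
  (the centre of a bounded set of a Hilbert space) and Prop. 2.2.9 (iv) ⇒ (v) (an isometric action with a bounded invariant
  set has a fixed point: the centre); §1.1 Prop. 1.1.9 (invariant vectors near almost-invariant vectors).
* C. Mœglin, M.-F. Vignéras, J.-L. Waldspurger, LNM 1291 (1987) [MoeglinVignerasWaldspurger1987], Chap. 2 I.8 (the
  projector `ρ'(f_A)` onto the `ψ_A`-vectors, of which this is the integral-free unitary counterpart).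
-/

set_option autoImplicit false

open scoped InnerProductSpace

namespace Literature.RepresentationTheory.Unitary

variable {E : Type*} [NormedAddCommGroup E] [InnerProductSpace ℂ E]

/-! ## §1 Uniqueness of the minimal-norm point of a midpoint-convex set -/

/-- **the point of minimal norm of a midpoint-convex set is unique**: if `a` has minimal norm on `K`, `b ∈ K` has the same
norm and the midpoint `½(a + b)` lies in `K`, then `a = b` (parallelogram law:
`‖a - b‖² = 2‖a‖² + 2‖b‖² - ‖a + b‖² ≤ 4d² - 4d² = 0`; the uniqueness half of the "lemma of the centre").
[cite: BekkaHarpeValette2008, §2.2 Lemma 2.2.7] -/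
theorem eq_of_forall_norm_le_of_midpoint_mem {K : Set E} {a b : E} (hmid : (2 : ℂ)⁻¹ • (a + b) ∈ K)
    (ha : ∀ w ∈ K, ‖a‖ ≤ ‖w‖) (hab : ‖b‖ = ‖a‖) : a = b := by
  have h1 : ‖a‖ ≤ 2⁻¹ * ‖a + b‖ := by
    have h := ha _ hmid
    rwa [norm_smul, norm_inv, Complex.norm_two] at h
  have hpar := parallelogram_law_with_norm ℂ a b
  rw [hab] at hpar
  have h2 : ‖a - b‖ * ‖a - b‖ ≤ 0 := by nlinarith [norm_nonneg (a + b), norm_nonneg a]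
  have h3 : ‖a - b‖ = 0 := le_antisymm (by nlinarith [norm_nonneg (a - b)]) (norm_nonneg _)
  exact sub_eq_zero.1 (norm_eq_zero.1 h3)

/-! ## §2 Fixed vectors next to an almost-invariant vector -/

variable [CompleteSpace E] {G : Type*} [Group G] (π : Representation ℂ G E)

/-- **an almost-invariant vector of an isometric action has an invariant vector nearby** (Bekka–de la Harpe–Valette,
proof of Prop. 2.2.9 (iv) ⇒ (v): an isometric action with a bounded invariant set `X` fixes "the centre of `X`", Lemma
2.2.7).  `π` acts by linear isometries, `H ≤ G`, `S` is a closed `π(H)`-stable subspace, `v ∈ S` with `‖π h v - v‖ ≤ ε`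
for all `h ∈ H` (the orbit `π(H) v` is an `H`-stable set inside the ball `B(v, ε)`); then some `u ∈ S` is fixed by every
`π h`, `h ∈ H`, and `‖u - v‖ ≤ ε`.  (Here `u` is taken to be the point of minimal norm of the closed convex `π(H)`-stable set
`{u ∈ S | ∀ h ∈ H, ‖u - π h v‖ ≤ ε}` rather than the circumcentre of the orbit; the conclusion is the printed one.)
[cite: BekkaHarpeValette2008, §2.2 Prop. 2.2.9 (iv)⇒(v) with Lemma 2.2.7] -/
theorem exists_fixed_near_of_forall_norm_sub_le (hπ : ∀ (g : G) (v : E), ‖π g v‖ = ‖v‖) (H : Subgroup G)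
    (S : Submodule ℂ E) (hSc : IsClosed (S : Set E)) (hS : ∀ g ∈ H, ∀ v ∈ S, π g v ∈ S)
    {v : E} (hv : v ∈ S) {ε : ℝ} (hε : ∀ g ∈ H, ‖π g v - v‖ ≤ ε) :
    ∃ u ∈ S, (∀ g ∈ H, π g u = u) ∧ ‖u - v‖ ≤ ε := by
  set K : Set E := {u | u ∈ S ∧ ∀ g ∈ H, ‖u - π g v‖ ≤ ε} with hK
  have hvK : v ∈ K := ⟨hv, fun g hg => by rw [norm_sub_rev]; exact hε g hg⟩
  have hKne : K.Nonempty := ⟨v, hvK⟩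
  have hKcl : IsClosed K := by
    have e : K = (S : Set E) ∩ ⋂ g ∈ H, {u | ‖u - π g v‖ ≤ ε} := by
      ext u
      simp only [hK, Set.mem_setOf_eq, Set.mem_inter_iff, SetLike.mem_coe, Set.mem_iInter]
    rw [e]
    exact hSc.inter (isClosed_biInter fun g _ =>
      isClosed_le (continuous_id.sub continuous_const).norm continuous_const)
  -- `K` is stable under `π h`, `h ∈ H`
  have hKinv : ∀ g ∈ H, ∀ u ∈ K, π g u ∈ K := by
    intro g hg u hu
    refine ⟨hS g hg u hu.1, fun g' hg' => ?_⟩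
    have e : π g u - π g' v = π g (u - π (g⁻¹ * g') v) := by
      rw [map_sub, ← Module.End.mul_apply, ← map_mul, mul_inv_cancel_left]
    rw [e, hπ]
    exact hu.2 _ (H.mul_mem (H.inv_mem hg) hg')
  -- `K` is midpoint-convex
  have hKmid : ∀ a ∈ K, ∀ b ∈ K, (2 : ℂ)⁻¹ • (a + b) ∈ K := by
    intro a ha b hb
    refine ⟨S.smul_mem _ (S.add_mem ha.1 hb.1), fun g hg => ?_⟩
    have e : (2 : ℂ)⁻¹ • (a + b) - π g v = (2 : ℂ)⁻¹ • ((a - π g v) + (b - π g v)) := by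
      have h2 : π g v = (2 : ℂ)⁻¹ • π g v + (2 : ℂ)⁻¹ • π g v := by
        rw [← add_smul]; norm_num
      conv_lhs => rw [h2]
      rw [smul_add (2 : ℂ)⁻¹ (a - π g v), smul_sub, smul_sub, smul_add]
      abel
    rw [e, norm_smul, norm_inv, Complex.norm_two]
    calc 2⁻¹ * ‖(a - π g v) + (b - π g v)‖ ≤ 2⁻¹ * (ε + ε) := by
          gcongr
          exact (norm_add_le _ _).trans (add_le_add (ha.2 g hg) (hb.2 g hg))
      _ = ε := by ring
  -- `K` is convex (over `ℝ`) and complete: it has a point of minimal norm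
  obtain ⟨u, huK, hmin⟩ : ∃ u ∈ K, ∀ w ∈ K, ‖u‖ ≤ ‖w‖ := by
    letI : InnerProductSpace ℝ E := InnerProductSpace.rclikeToReal ℂ E
    letI : Module ℝ E := RestrictScalars.module ℝ ℂ E
    have hc : Convex ℝ K := by
      intro a ha b hb s t hs ht hst
      have h1 : s • a = (s : ℂ) • a := rfl
      have h2 : t • b = (t : ℂ) • b := rfl
      rw [h1, h2]
      refine ⟨S.add_mem (S.smul_mem _ ha.1) (S.smul_mem _ hb.1), fun g hg => ?_⟩
      have e : (s : ℂ) • a + (t : ℂ) • b - π g v = (s : ℂ) • (a - π g v) + (t : ℂ) • (b - π g v) := by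
        have hx : π g v = (s : ℂ) • π g v + (t : ℂ) • π g v := by
          rw [← add_smul]; norm_cast; rw [hst]; simp
        conv_lhs => rw [hx]
        simp only [smul_sub]; abel
      rw [e]
      calc ‖(s : ℂ) • (a - π g v) + (t : ℂ) • (b - π g v)‖
          ≤ ‖(s : ℂ) • (a - π g v)‖ + ‖(t : ℂ) • (b - π g v)‖ := norm_add_le _ _
        _ = s * ‖a - π g v‖ + t * ‖b - π g v‖ := by
            rw [norm_smul, norm_smul, Complex.norm_real, Complex.norm_real, Real.norm_of_nonneg hs,
              Real.norm_of_nonneg ht]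
        _ ≤ s * ε + t * ε := by gcongr <;> [exact ha.2 g hg; exact hb.2 g hg]
        _ = ε := by rw [← add_mul, hst, one_mul]
    obtain ⟨u, hu, heq⟩ := exists_norm_eq_iInf_of_complete_convex hKne hKcl.isComplete hc (0 : E)
    refine ⟨u, hu, fun w hw => ?_⟩
    have hbdd : BddBelow (Set.range fun w : K => ‖(0 : E) - (w : E)‖) :=
      ⟨0, by rintro _ ⟨w, rfl⟩; exact norm_nonneg _⟩
    have h1 : ‖(0 : E) - u‖ ≤ ‖(0 : E) - ((⟨w, hw⟩ : K) : E)‖ := by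
      rw [heq]; exact ciInf_le hbdd ⟨w, hw⟩
    simpa using h1
  refine ⟨u, huK.1, fun g hg => ?_, ?_⟩
  · exact (eq_of_forall_norm_le_of_midpoint_mem (hKmid u huK _ (hKinv g hg u huK)) hmin (hπ g u)).symm
  · simpa using huK.2 1 H.one_mem

/-- **non-zero invariant vectors from almost-invariant ones**: if `‖π h v - v‖ ≤ ε < ‖v‖` uniformly in `h ∈ H`, some
NON-ZERO `u ∈ S` is fixed by `π(H)` (the fixed point of the previous theorem lies within `ε < ‖v‖` of `v`).
[cite: BekkaHarpeValette2008, §2.2 Prop. 2.2.9 (iv)⇒(v) with Lemma 2.2.7] -/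
theorem exists_fixed_ne_zero_of_forall_norm_sub_lt (hπ : ∀ (g : G) (v : E), ‖π g v‖ = ‖v‖) (H : Subgroup G)
    (S : Submodule ℂ E) (hSc : IsClosed (S : Set E)) (hS : ∀ g ∈ H, ∀ v ∈ S, π g v ∈ S)
    {v : E} (hv : v ∈ S) {ε : ℝ} (hεv : ε < ‖v‖) (hε : ∀ g ∈ H, ‖π g v - v‖ ≤ ε) :
    ∃ u ∈ S, u ≠ 0 ∧ ∀ g ∈ H, π g u = u := by
  obtain ⟨u, huS, hfix, hnear⟩ := exists_fixed_near_of_forall_norm_sub_le π hπ H S hSc hS hv hε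
  refine ⟨u, huS, fun h0 => ?_, hfix⟩
  rw [h0, zero_sub, norm_neg] at hnear
  exact lt_irrefl _ (hnear.trans_lt hεv)

end Literature.RepresentationTheory.Unitary
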